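import Mathlib.Analysis.SpecificLimits.Basic
import Mathlib.Analysis.SpecialFunctions.Log.Basic
import HarnessLib

/-!
# ζ(5) search — tail squeeze: exact approximation rates from geometrically shrinking steps (cell `pub-zeta5`, TYPER)

HONEST FRAMING: systematic search; no irrationality claim unless certified.

A small real-analysis tool used by the cell's exact-rate files. Let `r : ℕ → ℝ` converge to `L`
(think `rₙ = vₙ/uₙ`, the approximants of a recurrence family) and suppose the steps
`dₙ = r_{n+1} - rₙ` shrink geometrically from `n₀` on: `|d_{k+1}| ≤ θ|d_k|` (`k ≥ n₀`, `0 ≤ θ < 1`).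
For the cell's families `d_k = ±W_k/(u_k u_{k+1})` with `W` the Casoratian, so `θ` = (Casoratian ratio
bound)/(growth ratio bound)² is tiny (Apéry `1/33²`, Zudilin 2003 `1/7.5²`, Zudilin 2002 `1045/796²`).
Then, WHATEVER THE SIGNS of the steps:

* `abs_lim_sub_le` — `|L - rₙ| ≤ |dₙ|/(1 - θ)`;
* `abs_lim_sub_ge` — `(1 - 2θ)/(1 - θ) · |dₙ| ≤ |L - rₙ|` (non-trivial for `θ < 1/2`);
* `lim_sub_ne_zero` — hence `L ≠ rₙ` for `n ≥ n₀` when `θ < 1/2` and `dₙ ≠ 0`;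
* `tendsto_log_abs_lim_sub_div` — if moreover `log|dₙ|/n → ρ` then `log|L - rₙ|/n → ρ`:
  the approximation rate is EXACTLY the step rate.

Elementary (triangle inequality + geometric series + passage to the limit); 0 sorry. [folklore]
-/

noncomputable section

open Filter Topology Finset

namespace Summit.KontsevichZagierPeriods.Zeta5Search

namespace TailSqueeze

variable (r : ℕ → ℝ) {θ : ℝ} (n₀ : ℕ)

/-- Geometric shrinking propagates: `|d_{n+j}| ≤ θ^j |dₙ|` for `n ≥ n₀`. -/
theorem abs_step_add_le (hθ0 : 0 ≤ θ)
    (hcontr : ∀ k, n₀ ≤ k → |r (k + 2) - r (k + 1)| ≤ θ * |r (k + 1) - r k|)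
    (n : ℕ) (hn : n₀ ≤ n) (j : ℕ) :
    |r (n + j + 1) - r (n + j)| ≤ θ ^ j * |r (n + 1) - r n| := by
  induction j with
  | zero => simp
  | succ j ih =>
    have h := hcontr (n + j) (by omega)
    rw [show n + (j + 1) + 1 = n + j + 2 by ring, show n + (j + 1) = n + j + 1 by ring, pow_succ]
    calc |r (n + j + 2) - r (n + j + 1)| ≤ θ * |r (n + j + 1) - r (n + j)| := h
      _ ≤ θ * (θ ^ j * |r (n + 1) - r n|) := mul_le_mul_of_nonneg_left ih hθ0
      _ = θ ^ j * θ * |r (n + 1) - r n| := by ring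

/-- **Partial sums, upper**: `|r_{n+m} - rₙ| ≤ |dₙ| (1 - θ^m)/(1 - θ)` for `n ≥ n₀`. -/
theorem abs_sub_le_partial (hθ0 : 0 ≤ θ) (hθ1 : θ < 1)
    (hcontr : ∀ k, n₀ ≤ k → |r (k + 2) - r (k + 1)| ≤ θ * |r (k + 1) - r k|)
    (n : ℕ) (hn : n₀ ≤ n) (m : ℕ) :
    |r (n + m) - r n| ≤ |r (n + 1) - r n| * (1 - θ ^ m) / (1 - θ) := by
  have h1θ : 0 < 1 - θ := by linarith
  induction m with
  | zero => simp
  | succ m ih =>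
    have hstep := abs_step_add_le r n₀ hθ0 hcontr n hn m
    have htri : |r (n + (m + 1)) - r n| ≤ |r (n + m + 1) - r (n + m)| + |r (n + m) - r n| := by
      rw [show n + (m + 1) = n + m + 1 by ring]
      exact abs_sub_le _ _ _
    have halg : θ ^ m * |r (n + 1) - r n| + |r (n + 1) - r n| * (1 - θ ^ m) / (1 - θ) =
        |r (n + 1) - r n| * (1 - θ ^ (m + 1)) / (1 - θ) := by
      field_simp
      ring
    linarith

/-- **Partial sums, lower**: `(1 - 2θ)/(1 - θ) · |dₙ| ≤ |r_{n+1+m} - rₙ|` for `n ≥ n₀`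
(`|r_{n+1+m} - rₙ| ≥ |dₙ| - |r_{n+1+m} - r_{n+1}| ≥ |dₙ| - θ|dₙ|/(1-θ)`). -/
theorem le_abs_sub_partial (hθ0 : 0 ≤ θ) (hθ1 : θ < 1)
    (hcontr : ∀ k, n₀ ≤ k → |r (k + 2) - r (k + 1)| ≤ θ * |r (k + 1) - r k|)
    (n : ℕ) (hn : n₀ ≤ n) (m : ℕ) :
    (1 - 2 * θ) / (1 - θ) * |r (n + 1) - r n| ≤ |r (n + 1 + m) - r n| := by
  have h1θ : 0 < 1 - θ := by linarith
  have hup := abs_sub_le_partial r n₀ hθ0 hθ1 hcontr (n + 1) (by omega) m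
  have hd1 : |r (n + 1 + 1) - r (n + 1)| ≤ θ * |r (n + 1) - r n| := by
    have := hcontr n hn
    rwa [show n + 2 = n + 1 + 1 by ring] at this
  have hpow : 0 ≤ θ ^ m := pow_nonneg hθ0 _
  have hd0 : 0 ≤ |r (n + 1) - r n| := abs_nonneg _
  -- `|r (n+1+m) - r (n+1)| ≤ θ |d n| / (1 - θ)`
  have htail : |r (n + 1 + m) - r (n + 1)| ≤ θ * |r (n + 1) - r n| / (1 - θ) := by
    refine hup.trans (div_le_div_of_nonneg_right ?_ h1θ.le)
    nlinarith [abs_nonneg (r (n + 1 + 1) - r (n + 1))]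
  -- reverse triangle inequality
  have hrev : |r (n + 1) - r n| - |r (n + 1 + m) - r (n + 1)| ≤ |r (n + 1 + m) - r n| := by
    have := abs_sub_abs_le_abs_sub (r (n + 1) - r n) (r (n + 1) - r (n + 1 + m))
    rw [show r (n + 1) - r n - (r (n + 1) - r (n + 1 + m)) = r (n + 1 + m) - r n by ring,
      abs_sub_comm (r (n + 1)) (r (n + 1 + m))] at this
    exact this
  have halg : (1 - 2 * θ) / (1 - θ) * |r (n + 1) - r n| =
      |r (n + 1) - r n| - θ * |r (n + 1) - r n| / (1 - θ) := by
    field_simp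
    ring
  rw [halg]
  linarith

variable {L : ℝ}

/-- **Tail squeeze, upper**: `|L - rₙ| ≤ |dₙ|/(1 - θ)` for `n ≥ n₀`. -/
theorem abs_lim_sub_le (hθ0 : 0 ≤ θ) (hθ1 : θ < 1) (hlim : Tendsto r atTop (𝓝 L))
    (hcontr : ∀ k, n₀ ≤ k → |r (k + 2) - r (k + 1)| ≤ θ * |r (k + 1) - r k|)
    (n : ℕ) (hn : n₀ ≤ n) : |L - r n| ≤ |r (n + 1) - r n| / (1 - θ) := by
  have h1θ : 0 < 1 - θ := by linarith
  have hl : Tendsto (fun m : ℕ => |r (n + m) - r n|) atTop (𝓝 |L - r n|) := by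
    have h1 : Tendsto (fun m : ℕ => r (n + m)) atTop (𝓝 L) := by
      have := (tendsto_add_atTop_iff_nat n).2 hlim
      exact this.congr fun m => by rw [add_comm]
    exact (h1.sub_const _).abs
  refine le_of_tendsto hl (Eventually.of_forall fun m => ?_)
  refine (abs_sub_le_partial r n₀ hθ0 hθ1 hcontr n hn m).trans ?_
  have hpow : 0 ≤ θ ^ m := pow_nonneg hθ0 _
  refine div_le_div_of_nonneg_right ?_ h1θ.le
  nlinarith [abs_nonneg (r (n + 1) - r n)]

/-- **Tail squeeze, lower**: `(1 - 2θ)/(1 - θ) · |dₙ| ≤ |L - rₙ|` for `n ≥ n₀`. -/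
theorem abs_lim_sub_ge (hθ0 : 0 ≤ θ) (hθ1 : θ < 1) (hlim : Tendsto r atTop (𝓝 L))
    (hcontr : ∀ k, n₀ ≤ k → |r (k + 2) - r (k + 1)| ≤ θ * |r (k + 1) - r k|)
    (n : ℕ) (hn : n₀ ≤ n) : (1 - 2 * θ) / (1 - θ) * |r (n + 1) - r n| ≤ |L - r n| := by
  have hl : Tendsto (fun m : ℕ => |r (n + 1 + m) - r n|) atTop (𝓝 |L - r n|) := by
    have h1 : Tendsto (fun m : ℕ => r (n + 1 + m)) atTop (𝓝 L) := by
      have := (tendsto_add_atTop_iff_nat (n + 1)).2 hlim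
      exact this.congr fun m => by rw [add_comm]
    exact (h1.sub_const _).abs
  exact ge_of_tendsto hl (Eventually.of_forall fun m => le_abs_sub_partial r n₀ hθ0 hθ1 hcontr n hn m)

/-- **Non-vanishing**: for `θ < 1/2` and `dₙ ≠ 0`, `L ≠ rₙ` (`n ≥ n₀`). -/
theorem lim_sub_ne_zero (hθ0 : 0 ≤ θ) (hθ : θ < 1 / 2) (hlim : Tendsto r atTop (𝓝 L))
    (hcontr : ∀ k, n₀ ≤ k → |r (k + 2) - r (k + 1)| ≤ θ * |r (k + 1) - r k|)
    (n : ℕ) (hn : n₀ ≤ n) (hd : r (n + 1) ≠ r n) : L - r n ≠ 0 := by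
  have h := abs_lim_sub_ge r n₀ hθ0 (by linarith) hlim hcontr n hn
  have hc : 0 < (1 - 2 * θ) / (1 - θ) := div_pos (by linarith) (by linarith)
  have hd' : 0 < |r (n + 1) - r n| := abs_pos.2 (sub_ne_zero.2 hd)
  intro h0
  rw [h0, abs_zero] at h
  nlinarith [mul_pos hc hd']

/-- **Exact rate**: for `θ < 1/2`, if `log|dₙ|/n → ρ` then `log|L - rₙ|/n → ρ`. -/
theorem tendsto_log_abs_lim_sub_div (hθ0 : 0 ≤ θ) (hθ : θ < 1 / 2) (hlim : Tendsto r atTop (𝓝 L))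
    (hcontr : ∀ k, n₀ ≤ k → |r (k + 2) - r (k + 1)| ≤ θ * |r (k + 1) - r k|)
    (hd : ∀ k, n₀ ≤ k → r (k + 1) ≠ r k) {ρ : ℝ}
    (hrate : Tendsto (fun n : ℕ => Real.log |r (n + 1) - r n| / n) atTop (𝓝 ρ)) :
    Tendsto (fun n : ℕ => Real.log |L - r n| / n) atTop (𝓝 ρ) := by
  have hθ1 : θ < 1 := by linarith
  have h1θ : 0 < 1 - θ := by linarith
  have hc : 0 < (1 - 2 * θ) / (1 - θ) := div_pos (by linarith) h1θ
  -- lower companion `(log|dₙ| + log c)/n`, upper companion `(log|dₙ| + log (1/(1-θ)))/n`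
  have hlow : Tendsto (fun n : ℕ => Real.log |r (n + 1) - r n| / n +
      Real.log ((1 - 2 * θ) / (1 - θ)) / n) atTop (𝓝 ρ) := by
    have hc' : Tendsto (fun n : ℕ => Real.log ((1 - 2 * θ) / (1 - θ)) / (n : ℝ)) atTop (𝓝 0) :=
      tendsto_const_nhds.div_atTop tendsto_natCast_atTop_atTop
    have := hrate.add hc'
    rwa [add_zero] at this
  have hup : Tendsto (fun n : ℕ => Real.log |r (n + 1) - r n| / n +
      Real.log (1 / (1 - θ)) / n) atTop (𝓝 ρ) := by
    have hc' : Tendsto (fun n : ℕ => Real.log (1 / (1 - θ)) / (n : ℝ)) atTop (𝓝 0) :=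
      tendsto_const_nhds.div_atTop tendsto_natCast_atTop_atTop
    have := hrate.add hc'
    rwa [add_zero] at this
  refine tendsto_of_tendsto_of_tendsto_of_le_of_le' hlow hup ?_ ?_
  · filter_upwards [eventually_ge_atTop n₀, eventually_ge_atTop 1] with n hn h1
    have hn0 : (0 : ℝ) < n := by exact_mod_cast h1
    have hdn : 0 < |r (n + 1) - r n| := abs_pos.2 (sub_ne_zero.2 (hd n hn))
    rw [← add_div, ← Real.log_mul hdn.ne' hc.ne']
    refine div_le_div_of_nonneg_right (Real.log_le_log (mul_pos hdn hc) ?_) hn0.le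
    rw [mul_comm]
    exact abs_lim_sub_ge r n₀ hθ0 hθ1 hlim hcontr n hn
  · filter_upwards [eventually_ge_atTop n₀, eventually_ge_atTop 1] with n hn h1
    have hn0 : (0 : ℝ) < n := by exact_mod_cast h1
    have hdn : 0 < |r (n + 1) - r n| := abs_pos.2 (sub_ne_zero.2 (hd n hn))
    have he : 0 < |L - r n| := abs_pos.2 (lim_sub_ne_zero r n₀ hθ0 hθ hlim hcontr n hn (hd n hn))
    rw [← add_div, ← Real.log_mul hdn.ne' (by positivity)]
    refine div_le_div_of_nonneg_right (Real.log_le_log he ?_) hn0.le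
    rw [← div_eq_mul_one_div]
    exact abs_lim_sub_le r n₀ hθ0 hθ1 hlim hcontr n hn

end TailSqueeze

end Summit.KontsevichZagierPeriods.Zeta5Search
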